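import Mathlib
import Literature.Analysis.Complex.ZeroFreeOrder
import HarnessLib

/-!
# Zero-free holomorphic families cannot change their exponential growth rate

Topic `Literature/Analysis/Complex`. Everything in this file is PROVED.

The analytic core of the Beraha–Kahane–Weiss theorem on limits of zeros of sequences
`Z_M(a) = Σ_j α_j(a) λ_j(a)^M` (Beraha–Kahane–Weiss 1975/1978; Sokal, *Combin. Probab. Comput.* 13
(2004), Thm 3.2, "Vitali form"), isolated as a QUANTITATIVE statement about zero-free holomorphic
families on a disc, with no reference to eigenvalues:

* `exists_abs_log_norm_le_rpow_of_zeroFree` — for `0 < r₀ ≤ r < R` there are `A > 0`, `T ∈ (0,1)`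
  (depending only on `r₀, r, R`) such that every holomorphic zero-free `f` on `ball a R` with
  `‖f‖ ≤ e^L` on the ball (`L ≥ 1`) and `‖f − 1‖ ≤ 1/2` on `ball a r₀` obeys `|log ‖f z‖| ≤ A·L^T` on
  `closedBall a r`;
* `eventually_abs_log_norm_le_of_zeroFree` — hence for a family `f_M`, zero-free and holomorphic on
  `ball a R` with `‖f_M‖ ≤ e^{CM}` and `‖f_M − 1‖ ≤ 1/2` on `ball a r₀` for all large `M`,
  `(1/M) log ‖f_M‖ → 0` uniformly on `closedBall a r` for every `r < R`;
* `not_frequently_exp_mul_le_norm_of_zeroFree`, `not_frequently_norm_le_exp_neg_of_zeroFree` — so at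
  no point of the ball can `‖f_M‖` grow or decay exponentially along a subsequence.

Typical use (statistical mechanics): `f_M = Z_M / λ(a)^M` with `λ` the holomorphic branch of a
dominant transfer-matrix eigenvalue near `a₀`; if another eigenvalue overtakes `λ` in modulus at some
`a₁` of the disc, the `Z_M` must have zeros in the disc for infinitely many `M` (accumulation of
partition-function zeros on equimodular curves).

Proof (Titchmarsh-§14.2 mechanism, reusing the tree's `InvZetaRH.exists_log_of_ball` — holomorphic
logarithm on a disc with `g' = f'/f` — and `InvZetaRH.norm_le_of_three_circles` — Hadamard): with
`g = log f`, `g a = log (f a)`: (i) `‖g‖ ≤ 3/2` on `closedBall a (r₀/4)` by the Cauchy estimate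
`‖f'‖ ≤ 1/r₀`, `‖g'‖ = ‖f'/f‖ ≤ 2/r₀` and the mean value inequality; (ii) `Re g = log ‖f‖ ≤ L`, so
Borel–Carathéodory (Mathlib `Complex.borelCaratheodory`) bounds `‖g‖ ≤ B = O(L)` on
`closedBall a ((r+R)/2)`; (iii) three circles between radii `r₀/4` and `(r+R)/2` give
`‖g z‖ ≤ (3/2)^{1−s} B^s ≤ (3/2) B^T` with `T = log(4r/r₀)/log(2(r+R)/r₀) < 1`; (iv)
`|log ‖f‖| = |Re g| ≤ ‖g‖`.  For families, `B^T = O(M^T) = o(M)`.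

What is NOT here: the converse half of BKW (zeros DO accumulate only on equimodular loci / degeneracy
loci), Montel/Vitali compactness (not needed in this quantitative form; see `Montel.lean`,
`VitaliConvergence.lean` for those), and any spectral theory.

## References
* [BerahaKahaneWeiss1975] S. Beraha, J. Kahane, N. J. Weiss, PNAS 72 (1975) 4209 (announcement; full
  proof in Studies in Foundations and Combinatorics, Adv. Math. Suppl. Stud. 1 (1978) 213–232), Theorem,
  necessity of condition (b).
* A. D. Sokal, Chromatic roots are dense in the whole complex plane, Combin. Probab. Comput. 13 (2004)
  221–261, Theorem 3.2 (prose reference).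
* [Titchmarsh1986] §14.2 for the Borel–Carathéodory + three-circles mechanism.
-/

noncomputable section

open Complex Filter Metric Set
open scoped Real Topology

namespace Literature.Analysis.Complex

open Literature.NumberTheory.LFunctions.InvZetaRH (norm_le_of_three_circles exists_log_of_ball)

/-- **Inner bound for a holomorphic logarithm.** If `exp ∘ g = f` on `ball a R` with `g' = f'/f`,
`g a = log (f a)`, and `‖f − 1‖ ≤ 1/2` on `ball a r₀` (`0 < r₀ < R`), then `‖g‖ ≤ 3/2` on
`closedBall a (r₀/4)`: `‖g a‖ ≤ 1`, Cauchy's estimate `‖f'‖ ≤ 1/r₀` on circles of radius `r₀/2`,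
`‖f‖ ≥ 1/2`, so `‖g'‖ ≤ 2/r₀`, and the mean value inequality on the convex ball. [folklore] -/
theorem norm_logBranch_le_inner {f g : ℂ → ℂ} {a : ℂ} {r₀ R : ℝ} (hr₀ : 0 < r₀) (hr₀R : r₀ < R)
    (hf : DifferentiableOn ℂ f (ball a R))
    (hgd : ∀ z ∈ ball a R, HasDerivAt g (deriv f z / f z) z) (hga : g a = log (f a))
    (hone : ∀ z ∈ ball a r₀, ‖f z - 1‖ ≤ 1/2) :
    ∀ w ∈ closedBall a (r₀ / 4), ‖g w‖ ≤ 3/2 := by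
  have hga' : ‖g a‖ ≤ 1 := by
    rw [hga]; exact norm_log_le_one_of_norm_sub_one_le (hone a (mem_ball_self hr₀))
  have hflow : ∀ w ∈ ball a r₀, (1/2 : ℝ) ≤ ‖f w‖ := by
    intro w hw
    have h1 := hone w hw
    have h3 : ‖(1:ℂ)‖ ≤ ‖f w‖ + ‖1 - f w‖ := by
      have := norm_add_le (f w) (1 - f w)
      have e : f w + (1 - f w) = 1 := by ring
      rwa [e] at this
    have e2 : ‖1 - f w‖ = ‖f w - 1‖ := by rw [← norm_neg]; congr 1; ring
    rw [norm_one, e2] at h3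
    linarith
  have hclosed : closedBall a (r₀ / 4) ⊆ ball a r₀ := closedBall_subset_ball (by linarith)
  have hballR : ball a r₀ ⊆ ball a R := ball_subset_ball hr₀R.le
  have hderf : ∀ w ∈ closedBall a (r₀ / 4), ‖deriv f w‖ ≤ 1 / r₀ := by
    intro w hw
    have hw' : dist w a ≤ r₀ / 4 := mem_closedBall.mp hw
    have hsub : closedBall w (r₀/2) ⊆ ball a R := by
      intro x hx
      have hx' : dist x w ≤ r₀/2 := mem_closedBall.mp hx
      rw [mem_ball]
      calc dist x a ≤ dist x w + dist w a := dist_triangle _ _ _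
        _ ≤ r₀/2 + r₀/4 := by linarith
        _ < R := by linarith
    have hdc : DiffContOnCl ℂ (fun x => f x - 1) (ball w (r₀/2)) :=
      (hf.sub_const 1).diffContOnCl_ball hsub
    have hsph : ∀ x ∈ sphere w (r₀/2), ‖f x - 1‖ ≤ 1/2 := by
      intro x hx
      apply hone
      have hx' : dist x w = r₀/2 := mem_sphere.mp hx
      rw [mem_ball]
      calc dist x a ≤ dist x w + dist w a := dist_triangle _ _ _
        _ ≤ r₀/2 + r₀/4 := by linarith
        _ < r₀ := by linarith
    have := Complex.norm_deriv_le_of_forall_mem_sphere_norm_le (by positivity) hdc hsph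
    rw [deriv_sub_const] at this
    calc ‖deriv f w‖ ≤ 1 / 2 / (r₀ / 2) := this
      _ = 1 / r₀ := by field_simp
  have hderg : ∀ w ∈ closedBall a (r₀ / 4), ‖deriv g w‖ ≤ 2 / r₀ := by
    intro w hw
    have hwR : w ∈ ball a R := hballR (hclosed hw)
    rw [(hgd w hwR).deriv, norm_div]
    have h1 := hderf w hw
    have h2 := hflow w (hclosed hw)
    have hpos : 0 < ‖f w‖ := by linarith
    rw [div_le_div_iff₀ hpos hr₀]
    calc ‖deriv f w‖ * r₀ ≤ (1 / r₀) * r₀ := by gcongr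
      _ = 1 := by field_simp
      _ ≤ 2 * ‖f w‖ := by linarith
  intro w hw
  have hmv : ‖g w - g a‖ ≤ 2 / r₀ * ‖w - a‖ :=
    (convex_closedBall a (r₀ / 4)).norm_image_sub_le_of_norm_deriv_le
      (fun x hx => (hgd x (hballR (hclosed hx))).differentiableAt)
      hderg (mem_closedBall_self (by positivity)) hw
  have hwa : ‖w - a‖ ≤ r₀ / 4 := by rw [← dist_eq_norm]; exact mem_closedBall.mp hw
  have h3 : ‖g w - g a‖ ≤ 1/2 := by
    calc ‖g w - g a‖ ≤ 2 / r₀ * ‖w - a‖ := hmv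
      _ ≤ 2 / r₀ * (r₀ / 4) := by gcongr
      _ = 1/2 := by field_simp; ring
  calc ‖g w‖ = ‖(g w - g a) + g a‖ := by ring_nf
    _ ≤ ‖g w - g a‖ + ‖g a‖ := norm_add_le _ _
    _ ≤ 1/2 + 1 := by linarith
    _ = 3/2 := by norm_num

/-- **Outer bound (Borel–Carathéodory).** If `g` is holomorphic on `ball a R` with `Re g ≤ L`
(`L > 0`) there and `‖g a‖ ≤ 1`, then `‖g‖ ≤ 2 L R₁/(R − R₁) + (R + R₁)/(R − R₁)` on
`closedBall a R₁` for `0 ≤ R₁ < R` (Mathlib `Complex.borelCaratheodory`). [folklore] -/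
theorem norm_logBranch_le_outer {g : ℂ → ℂ} {a : ℂ} {R₁ R L : ℝ} (hR₁ : 0 ≤ R₁) (hR₁R : R₁ < R)
    (hL : 0 < L) (hg : DifferentiableOn ℂ g (ball a R)) (hreL : ∀ w ∈ ball a R, (g w).re ≤ L)
    (hga : ‖g a‖ ≤ 1) :
    ∀ w ∈ closedBall a R₁, ‖g w‖ ≤ 2 * L * R₁ / (R - R₁) + (R + R₁) / (R - R₁) := by
  intro w hw
  have hRpos : 0 < R := lt_of_le_of_lt hR₁ hR₁R
  have hRR₁ : 0 < R - R₁ := by linarith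
  set G : ℂ → ℂ := fun v => g (a + v) with hG
  have hGd : DifferentiableOn ℂ G (ball 0 R) := by
    apply hg.comp (differentiableOn_id.const_add a)
    intro v hv
    rw [mem_ball, dist_eq_norm] at hv ⊢
    simpa using hv
  have hGmaps : Set.MapsTo G (ball 0 R) {z | z.re ≤ L} := by
    intro v hv
    apply hreL
    rw [mem_ball, dist_eq_norm] at hv ⊢
    simpa using hv
  have hv : w - a ∈ ball (0 : ℂ) R := by
    rw [mem_ball, dist_zero_right, ← dist_eq_norm]
    exact lt_of_le_of_lt (mem_closedBall.mp hw) hR₁R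
  have hBC := Complex.borelCaratheodory hL hGd hGmaps hRpos hv
  have eG : G (w - a) = g w := by simp [hG]
  have eG0 : G 0 = g a := by simp [hG]
  rw [eG, eG0] at hBC
  have hn : ‖w - a‖ ≤ R₁ := by rw [← dist_eq_norm]; exact mem_closedBall.mp hw
  have hn0 : 0 ≤ ‖w - a‖ := norm_nonneg _
  have hden : 0 < R - ‖w - a‖ := by linarith
  have h1 : 2 * L * ‖w - a‖ / (R - ‖w - a‖) ≤ 2 * L * R₁ / (R - R₁) := by
    rw [div_le_div_iff₀ hden hRR₁]
    have key : 2 * L * ‖w - a‖ * R ≤ 2 * L * R₁ * R := by gcongr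
    nlinarith [key]
  have h2 : ‖g a‖ * (R + ‖w - a‖) / (R - ‖w - a‖) ≤ (R + R₁) / (R - R₁) := by
    rw [div_le_div_iff₀ hden hRR₁]
    have h21 : ‖g a‖ * (R + ‖w - a‖) * (R - R₁) ≤ 1 * ((R + ‖w - a‖) * (R - R₁)) := by
      rw [mul_assoc]
      exact mul_le_mul_of_nonneg_right hga (by positivity)
    have h22 : (R + ‖w - a‖) * (R - R₁) ≤ (R + R₁) * (R - ‖w - a‖) := by nlinarith
    nlinarith
  calc ‖g w‖ ≤ 2 * L * ‖w - a‖ / (R - ‖w - a‖) + ‖g a‖ * (R + ‖w - a‖) / (R - ‖w - a‖) := hBC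
    _ ≤ _ := add_le_add h1 h2

/-- **Quantitative core (one function).** Let `0 < r₀ ≤ r < R`.  There are constants `A > 0` and
`T ∈ (0,1)`, depending only on `r₀, r, R`, such that every holomorphic zero-free `f` on `ball a R` with
`‖f‖ ≤ e^L` (`L ≥ 1`) on the ball and `‖f − 1‖ ≤ 1/2` on `ball a r₀` satisfies
`|log ‖f z‖| ≤ A · L^T` on `closedBall a r` (holomorphic logarithm, inner bound `3/2`,
Borel–Carathéodory, Hadamard three circles; `A = (3/2) b^T`, `b = 2R₁/(R−R₁) + (R+R₁)/(R−R₁) + 3/2`,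
`R₁ = (r+R)/2`, `T = log(4r/r₀)/log(4R₁/r₀)`).
[cite: BerahaKahaneWeiss1975, Theorem (necessity of (b)), quantitative disc form] -/
theorem exists_abs_log_norm_le_rpow_of_zeroFree (r₀ r R : ℝ) (hr₀ : 0 < r₀) (hr₀r : r₀ ≤ r)
    (hrR : r < R) :
    ∃ A T : ℝ, 0 < A ∧ 0 < T ∧ T < 1 ∧ ∀ (f : ℂ → ℂ) (a : ℂ) (L : ℝ), 1 ≤ L →
      DifferentiableOn ℂ f (ball a R) → (∀ z ∈ ball a R, f z ≠ 0) →
      (∀ z ∈ ball a R, ‖f z‖ ≤ Real.exp L) → (∀ z ∈ ball a r₀, ‖f z - 1‖ ≤ 1/2) →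
      ∀ z ∈ closedBall a r, |Real.log ‖f z‖| ≤ A * L ^ T := by
  -- geometry
  set ρ₀ : ℝ := r₀ / 4 with hρ₀
  set R₁ : ℝ := (r + R) / 2 with hR₁
  have hρ₀pos : 0 < ρ₀ := by positivity
  have hρ₀r : ρ₀ < r := by rw [hρ₀]; linarith
  have hrR₁ : r < R₁ := by rw [hR₁]; linarith
  have hR₁R : R₁ < R := by rw [hR₁]; linarith
  have hR₁pos : 0 < R₁ := by linarith
  have hRpos : 0 < R := by linarith
  have hRR₁ : 0 < R - R₁ := by linarith
  have hlog₁ : 0 < Real.log (R₁ / ρ₀) := Real.log_pos ((one_lt_div hρ₀pos).mpr (by linarith))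
  set T : ℝ := Real.log (r / ρ₀) / Real.log (R₁ / ρ₀) with hT
  have hT0 : 0 < T := div_pos (Real.log_pos ((one_lt_div hρ₀pos).mpr hρ₀r)) hlog₁
  have hT1 : T < 1 := by
    rw [hT, div_lt_one hlog₁]
    exact Real.log_lt_log (div_pos (by linarith) hρ₀pos) (div_lt_div_of_pos_right hrR₁ hρ₀pos)
  set b : ℝ := 2 * R₁ / (R - R₁) + (R + R₁) / (R - R₁) + 3/2 with hb
  have hbpos : 0 < b := by
    have h1 : 0 ≤ 2 * R₁ / (R - R₁) := by positivity
    have h2 : 0 ≤ (R + R₁) / (R - R₁) := by positivity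
    rw [hb]; linarith
  refine ⟨(3/2) * b ^ T, T, by positivity, hT0, hT1, ?_⟩
  intro f a L hL hf h0 hbd hone z hz
  have hLpos : 0 < L := by linarith
  -- normalised holomorphic logarithm and its real part
  obtain ⟨g, hg, hga, hgd, hge⟩ := exists_log_of_ball hRpos hf h0
  have hre : ∀ w ∈ ball a R, (g w).re = Real.log ‖f w‖ := by
    intro w hw
    rw [← hge w hw, Complex.norm_exp, Real.log_exp]
  have hreL : ∀ w ∈ ball a R, (g w).re ≤ L := by
    intro w hw
    rw [hre w hw]
    have hpos : 0 < ‖f w‖ := norm_pos_iff.mpr (h0 w hw)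
    calc Real.log ‖f w‖ ≤ Real.log (Real.exp L) := Real.log_le_log hpos (hbd w hw)
      _ = L := Real.log_exp L
  have hga' : ‖g a‖ ≤ 1 := by
    rw [hga]; exact norm_log_le_one_of_norm_sub_one_le (hone a (mem_ball_self hr₀))
  -- inner and outer bounds
  have hinner := norm_logBranch_le_inner hr₀ (by linarith) hf hgd hga hone
  set B₀ : ℝ := 2 * L * R₁ / (R - R₁) + (R + R₁) / (R - R₁) with hB₀
  have houter : ∀ w ∈ closedBall a R₁, ‖g w‖ ≤ B₀ :=
    norm_logBranch_le_outer hR₁pos.le hR₁R hLpos hg hreL hga'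
  set B : ℝ := B₀ + 3/2 with hB
  have hB₀nn : 0 ≤ B₀ := by rw [hB₀]; positivity
  have hB32 : 3/2 ≤ B := by rw [hB]; linarith
  have hB1 : 1 ≤ B := by linarith
  have hBbL : B ≤ b * L := by
    have e : b * L = 2 * L * R₁ / (R - R₁) + ((R + R₁) / (R - R₁)) * L + 3/2 * L := by
      rw [hb]; ring
    rw [e, hB, hB₀]
    have h1 : (R + R₁) / (R - R₁) ≤ ((R + R₁) / (R - R₁)) * L := by
      have h0 : 0 ≤ (R + R₁) / (R - R₁) := by positivity
      nlinarith
    nlinarith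
  -- the key bound ‖g z‖ ≤ 3/2 · B^T
  have hzR : z ∈ ball a R := closedBall_subset_ball (by linarith) hz
  have hkey : ‖g z‖ ≤ (3/2) * B ^ T := by
    have hBT1 : (1 : ℝ) ≤ B ^ T := Real.one_le_rpow hB1 hT0.le
    by_cases hzin : ‖z - a‖ ≤ ρ₀
    · have h1 : ‖g z‖ ≤ 3/2 := hinner z (by rw [mem_closedBall, dist_eq_norm]; exact hzin)
      calc ‖g z‖ ≤ 3/2 * 1 := by linarith
        _ ≤ 3/2 * B ^ T := by gcongr
    · push Not at hzin
      have hza' : ‖z - a‖ ≤ r := by rw [← dist_eq_norm]; exact mem_closedBall.mp hz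
      have h3 := norm_le_of_three_circles hρ₀pos (by linarith : ρ₀ < R₁) hR₁R hg
        (fun w hw => hinner w (by rw [mem_closedBall, dist_eq_norm]; exact hw.le))
        (fun w hw => show ‖g w‖ ≤ B from
          (houter w (by rw [mem_closedBall, dist_eq_norm]; exact hw.le)).trans (by rw [hB]; linarith))
        hzin.le (by linarith)
      set s : ℝ := Real.log (‖z - a‖ / ρ₀) / Real.log (R₁ / ρ₀) with hs
      have hza0 : 0 < ‖z - a‖ := lt_trans hρ₀pos hzin
      have hs0 : 0 ≤ s :=
        div_nonneg (Real.log_nonneg ((one_le_div hρ₀pos).mpr hzin.le)) hlog₁.le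
      have hsT : s ≤ T := by
        rw [hs, hT]
        apply div_le_div_of_nonneg_right _ hlog₁.le
        exact Real.log_le_log (div_pos hza0 hρ₀pos) (div_le_div_of_nonneg_right hza' hρ₀pos.le)
      have h4 : (3/2 : ℝ) ^ (1 - s) ≤ 3/2 := by
        calc (3/2 : ℝ) ^ (1 - s) ≤ (3/2 : ℝ) ^ (1 : ℝ) :=
              Real.rpow_le_rpow_of_exponent_le (by norm_num) (by linarith)
          _ = 3/2 := Real.rpow_one _
      have h5 : B ^ s ≤ B ^ T := Real.rpow_le_rpow_of_exponent_le hB1 hsT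
      have h6 : 0 ≤ B ^ s := Real.rpow_nonneg (by linarith) s
      calc ‖g z‖ ≤ (3/2 : ℝ) ^ (1 - s) * B ^ s := h3
        _ ≤ (3/2) * B ^ T := mul_le_mul h4 h5 h6 (by norm_num)
  -- finish
  have hfin : |Real.log ‖f z‖| ≤ ‖g z‖ := by
    rw [← hre z hzR]; exact Complex.abs_re_le_norm _
  have hBTle : B ^ T ≤ (b * L) ^ T := Real.rpow_le_rpow (by linarith) hBbL hT0.le
  have hsplit : (b * L) ^ T = b ^ T * L ^ T := Real.mul_rpow hbpos.le (by linarith)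
  calc |Real.log ‖f z‖| ≤ ‖g z‖ := hfin
    _ ≤ (3/2) * B ^ T := hkey
    _ ≤ (3/2) * (b * L) ^ T := by gcongr
    _ = (3/2) * b ^ T * L ^ T := by rw [hsplit]; ring

/-- **Zero-free holomorphic families keep their exponential growth rate** (analytic core of the
Beraha–Kahane–Weiss theorem, quantitative Vitali form).  If `f_M` is holomorphic and zero-free on
`ball a R` for all large `M`, with `‖f_M‖ ≤ e^{CM}` there and `‖f_M − 1‖ ≤ 1/2` on a fixed smaller
ball `ball a r₀`, then for every `r < R` and `ε > 0`, eventually `|log ‖f_M z‖| ≤ εM` on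
`closedBall a r`.  [cite: BerahaKahaneWeiss1975, Theorem (necessity of (b))] -/
theorem eventually_abs_log_norm_le_of_zeroFree {f : ℕ → ℂ → ℂ} {a : ℂ} {r₀ r R C : ℝ}
    (hr₀ : 0 < r₀) (hr₀r : r₀ ≤ r) (hrR : r < R)
    (hdiff : ∀ᶠ M in atTop, DifferentiableOn ℂ (f M) (ball a R))
    (hne : ∀ᶠ M in atTop, ∀ z ∈ ball a R, f M z ≠ 0)
    (hbd : ∀ᶠ M in atTop, ∀ z ∈ ball a R, ‖f M z‖ ≤ Real.exp (C * M))
    (hone : ∀ᶠ M in atTop, ∀ z ∈ ball a r₀, ‖f M z - 1‖ ≤ 1/2) :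
    ∀ ε > 0, ∀ᶠ M in atTop, ∀ z ∈ closedBall a r, |Real.log ‖f M z‖| ≤ ε * M := by
  obtain ⟨A, T, hA, hT0, hT1, hcore⟩ := exists_abs_log_norm_le_rpow_of_zeroFree r₀ r R hr₀ hr₀r hrR
  intro ε hε
  set C' : ℝ := max C 1 with hC'
  have hC'1 : 1 ≤ C' := le_max_right _ _
  have hlim : Tendsto (fun M : ℕ => A * C' ^ T * (M : ℝ) ^ (T - 1)) atTop (𝓝 0) := by
    have h1 : Tendsto (fun x : ℝ => x ^ (T - 1)) atTop (𝓝 0) := by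
      have := tendsto_rpow_neg_atTop (y := 1 - T) (by linarith)
      simpa [neg_sub] using this
    have h2 := h1.comp tendsto_natCast_atTop_atTop
    simpa using h2.const_mul (A * C' ^ T)
  have hev : ∀ᶠ M : ℕ in atTop, A * C' ^ T * (M : ℝ) ^ (T - 1) ≤ ε :=
    hlim.eventually (Iic_mem_nhds hε)
  filter_upwards [hdiff, hne, hbd, hone, hev, eventually_ge_atTop 1] with M hd hn hb ho hM hM1
  intro z hz
  have hM1' : (1 : ℝ) ≤ M := by exact_mod_cast hM1
  have hMpos : (0 : ℝ) < M := by linarith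
  have hL : 1 ≤ C' * M := by nlinarith
  have hb' : ∀ z ∈ ball a R, ‖f M z‖ ≤ Real.exp (C' * M) := fun w hw =>
    (hb w hw).trans (Real.exp_le_exp.mpr (by nlinarith [le_max_left C 1]))
  have h := hcore (f M) a (C' * M) hL hd hn hb' ho z hz
  have hsplit : (C' * (M : ℝ)) ^ T = C' ^ T * ((M : ℝ) ^ (T - 1) * M) := by
    rw [Real.mul_rpow (by linarith) hMpos.le, Real.rpow_sub_one hMpos.ne']
    field_simp
  calc |Real.log ‖f M z‖| ≤ A * (C' * M) ^ T := h
    _ = A * C' ^ T * (M : ℝ) ^ (T - 1) * M := by rw [hsplit]; ring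
    _ ≤ ε * M := by gcongr

/-- Consequence: under the hypotheses of `eventually_abs_log_norm_le_of_zeroFree`, at NO point of the
ball can `‖f_M‖` grow exponentially along a subsequence (in the transfer-matrix reading: no second
eigenvalue can overtake the normaliser anywhere in a zero-free disc).
[cite: BerahaKahaneWeiss1975, Theorem (necessity of (b))] -/
theorem not_frequently_exp_mul_le_norm_of_zeroFree {f : ℕ → ℂ → ℂ} {a : ℂ} {r₀ R C : ℝ}
    (hr₀ : 0 < r₀) (hr₀R : r₀ < R)
    (hdiff : ∀ᶠ M in atTop, DifferentiableOn ℂ (f M) (ball a R))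
    (hne : ∀ᶠ M in atTop, ∀ z ∈ ball a R, f M z ≠ 0)
    (hbd : ∀ᶠ M in atTop, ∀ z ∈ ball a R, ‖f M z‖ ≤ Real.exp (C * M))
    (hone : ∀ᶠ M in atTop, ∀ z ∈ ball a r₀, ‖f M z - 1‖ ≤ 1/2)
    {z : ℂ} (hz : z ∈ ball a R) {η : ℝ} (hη : 0 < η) :
    ¬ ∃ᶠ M : ℕ in atTop, Real.exp (η * M) ≤ ‖f M z‖ := by
  intro hfr
  set r : ℝ := max r₀ ‖z - a‖ with hr
  have hr₀r : r₀ ≤ r := le_max_left _ _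
  have hzr : z ∈ closedBall a r := by
    rw [mem_closedBall, dist_eq_norm]; exact le_max_right _ _
  have hrR : r < R := max_lt hr₀R (by rwa [mem_ball, dist_eq_norm] at hz)
  have hev := eventually_abs_log_norm_le_of_zeroFree hr₀ hr₀r hrR hdiff hne hbd hone (η / 2)
    (by positivity)
  obtain ⟨M, hM, hM', hM1⟩ := (hfr.and_eventually (hev.and (eventually_ge_atTop 1))).exists
  have hM1' : (1 : ℝ) ≤ M := by exact_mod_cast hM1
  have h1 := hM' z hzr
  have hpos : 0 < Real.exp (η * M) := Real.exp_pos _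
  have h2 : η * M ≤ Real.log ‖f M z‖ := by
    rw [← Real.log_exp (η * M)]
    exact Real.log_le_log hpos hM
  have h3 : Real.log ‖f M z‖ ≤ η / 2 * M := le_trans (le_abs_self _) h1
  nlinarith

/-- Consequence: under the hypotheses of `eventually_abs_log_norm_le_of_zeroFree`, at NO point of the
ball can `‖f_M‖` decay exponentially along a subsequence.
[cite: BerahaKahaneWeiss1975, Theorem (necessity of (b))] -/
theorem not_frequently_norm_le_exp_neg_of_zeroFree {f : ℕ → ℂ → ℂ} {a : ℂ} {r₀ R C : ℝ}
    (hr₀ : 0 < r₀) (hr₀R : r₀ < R)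
    (hdiff : ∀ᶠ M in atTop, DifferentiableOn ℂ (f M) (ball a R))
    (hne : ∀ᶠ M in atTop, ∀ z ∈ ball a R, f M z ≠ 0)
    (hbd : ∀ᶠ M in atTop, ∀ z ∈ ball a R, ‖f M z‖ ≤ Real.exp (C * M))
    (hone : ∀ᶠ M in atTop, ∀ z ∈ ball a r₀, ‖f M z - 1‖ ≤ 1/2)
    {z : ℂ} (hz : z ∈ ball a R) {η : ℝ} (hη : 0 < η) :
    ¬ ∃ᶠ M : ℕ in atTop, ‖f M z‖ ≤ Real.exp (-(η * M)) := by
  intro hfr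
  set r : ℝ := max r₀ ‖z - a‖ with hr
  have hr₀r : r₀ ≤ r := le_max_left _ _
  have hzr : z ∈ closedBall a r := by
    rw [mem_closedBall, dist_eq_norm]; exact le_max_right _ _
  have hrR : r < R := max_lt hr₀R (by rwa [mem_ball, dist_eq_norm] at hz)
  have hev := eventually_abs_log_norm_le_of_zeroFree hr₀ hr₀r hrR hdiff hne hbd hone (η / 2)
    (by positivity)
  obtain ⟨M, hM, ⟨hM', hM1⟩, hMz⟩ :=
    (hfr.and_eventually ((hev.and (eventually_ge_atTop 1)).and hne)).exists
  have hM1' : (1 : ℝ) ≤ M := by exact_mod_cast hM1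
  have h1 := hM' z hzr
  have hpos : 0 < ‖f M z‖ := norm_pos_iff.mpr (hMz z hz)
  have h2 : Real.log ‖f M z‖ ≤ -(η * M) := by
    rw [← Real.log_exp (-(η * M))]
    exact Real.log_le_log hpos hM
  have h3 : -(η / 2 * M) ≤ Real.log ‖f M z‖ := by
    have := neg_abs_le (Real.log ‖f M z‖)
    linarith
  nlinarith

end Literature.Analysis.Complex
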